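import Literature.NumberTheory.EllipticCurves.ZpExtensionShapiroToEisensteinTowerHom
import Literature.NumberTheory.EllipticCurves.ZpExtensionCoeffSelmerStructure
import Literature.NumberTheory.EllipticCurves.IwasawaTwistModPkTower
import Literature.NumberTheory.GaloisRepresentations.StrictSubgroupFunctorialityProofs
import HarnessLib

/-!
# The two TRIANGLES of the Kolyvagin-system pushforward's level maps `f_{σ,k} : E[p^σ] ⊗ Λ/(ω_σ,p^σ) → E[p^k] ⊗ A_{m,k}`,
# their local-`H¹` forms, and «cores ↦ cores» at every finite place (theorems only)

Topic `NumberTheory/EllipticCurves` (sequel of `ZpExtensionShapiroToEisensteinTowerHom` (C10), `…BaseChange` (G2),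
`ZpExtensionCoeffSelmerStructure` (lit A1)).  Cell `pub/bsd-print-x9`, seat `bsd-line-x9-p2` g4: inputs of the `cond_le`
field (Howard Rem. 1.2.4 (ii)+(iii) / Lemma 2.2.7 «`H¹_{F_Λ}(K_v, 𝐓/I𝐓) → H¹_{F_𝔭}(K_v, T_𝔭)`», arXiv:1202.6340 p. 16
L142–148) of the ONE `Hom` from the `Λ`-adic source into the Eisenstein DVR setting (STUB A of the shared μ-crux), for the
tower algebra `Tower.map_exactLevelCondition_le_levelCondition` (G4a, `TowerExactFamiliesTransferProofs`):

* §1 the triangles ON THE CARRIERS: **(T1)** `f_{σ,k} ∘ red_σ = f_{σ+1,k}` (`[c] ⊗ p^{σ−k}(pP) = [c] ⊗ p^{σ+1−k}P`;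
  `shapiroToEisensteinTwistLe_coeffLevelReduce`) and **(T2)** `red′_k ∘ f_{σ,k+1} = f_{σ,k}` (`[c] ⊗ t_k(p^{σ−k−1}P) =
  [c] ⊗ p^{σ−k}P`; `eisensteinTwistReduce_shapiroToEisensteinTwistLe`) — both by `coeffTwistReduce_comp_apply` / `_congr`;
* §2 their LOCAL `H¹` forms at a place `v` along lit's `coeffLocalRed` (source local tower) and D1's `eisensteinLocalReduce`
  (target local tower) (`map_localMap_shapiroToEisensteinTwistLe_coeffLocalRed`, `eisensteinLocalReduce_map_localMap_…`);
* §3 admissibility `k ≤ σ ∧ (ω_σ, p^σ) ≤ (q_m, p^k)` is upward closed in `σ` and realised for every `k` (`exists_forall_adm`);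
* §4 at `v ∣ p`: `f_{σ,k}` carries the source plus part `(Λ/I_σ) ⊗ Fil_v E[p^σ]` into the target plus part `A_{m,k} ⊗ Fil_v E[p^k]`
  for ONE ordinary filtration `Φ` of the module tower (`OrdinaryFiltration.torsionGaloisModulePowReduce_mem_fil`,
  `shapiroToEisensteinTwistLe_mem_twistedFil`), hence the source ordinary core into the target ordinary core
  (`map_localMap_shapiroToEisensteinTwistLe_mem_ordinaryCore`, via the tree's `map_mem_strictSubgroup`); at any finite place
  unramified classes go to unramified classes (`…_mem_unramifiedSubgroup`).
Theorems only; no named fact, no instance, no notation, no `sorry`.  BSD is not proved by any of this.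

References: [Howard2004HeegnerKolyvagin] Rem. 1.2.4, Lemma 2.2.7, Def. 2.2.5–2.2.6, §1.6 (arXiv p. 7 L13–27, p. 12 L29–33, p0016
L84–148); [SerreGaloisCohomology1997] I §2.2, §2.4 (functoriality, compatible pairs); [SilvermanAEC2009] III.§7.
-/

noncomputable section

open scoped TensorProduct Topology Classical ContRepresentation
open Field CategoryTheory IsLocalRing IsDedekindDomain
open scoped NumberField

namespace Literature.NumberTheory.EllipticCurves.ZpExtension

open Literature.NumberTheory.GaloisRepresentations
open Literature.NumberTheory.GaloisCohomology.Howard2004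

variable {K : Type} [Field K] {V : WeierstrassCurve K} {p : ℕ} [hp : Fact p.Prime] (κ : ZpExtension K p)
  (t : ∀ k, (V.torsionGaloisModule ((p : ℤ) ^ (k + 1))).toContRepresentation →ⁱL
    (V.torsionGaloisModule ((p : ℤ) ^ k)).toContRepresentation)
  (ht : ∀ k (P : WeierstrassCurve.geomTorsion V ((p : ℤ) ^ (k + 1))), t k P = V.geomTorsionReduce p k P)
  (hts : ∀ k, Function.Surjective (t k)) {m : ℕ} (hm : 1 ≤ m)

/-! ## §1 The triangles on the carriers -/

include ht in
/-- **(T1) `f_{σ,k} ∘ red_σ = f_{σ+1,k}`** on the carriers: reducing one step in the Shapiro source (`coeffLevelReduce`: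
`c ⊗ P ↦ (c mod I_σ) ⊗ t_σ P`) then mapping to `E[p^k] ⊗ A_{m,k}` at source level `σ` is mapping at source level `σ+1`.
[cite: Howard2004HeegnerKolyvagin, Rem. 1.2.4 and §1.6 (arXiv p. 7 L13–27, p. 12 L29–33)] -/
theorem shapiroToEisensteinTwistLe_coeffLevelReduce (σ k : ℕ) (hσ : k ≤ σ) (hσ' : k ≤ σ + 1)
    (hle : shapiroIdeal p σ ≤ Ideal.span {(PowerSeries.X ^ m + PowerSeries.C (p : ℤ_[p]) : IwasawaAlgebra p)} ⊔
      Ideal.span {PowerSeries.C ((p : ℤ_[p]) ^ k)})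
    (hle' : shapiroIdeal p (σ + 1) ≤ Ideal.span {(PowerSeries.X ^ m + PowerSeries.C (p : ℤ_[p]) : IwasawaAlgebra p)} ⊔
      Ideal.span {PowerSeries.C ((p : ℤ_[p]) ^ k)})
    (y : QuotTwisted (IwasawaAlgebra p ⧸ shapiroIdeal p (σ + 1)) (WeierstrassCurve.geomTorsion V ((p : ℤ) ^ (σ + 1)))) :
    κ.shapiroToEisensteinTwistLe V hm σ k hσ hle
        (κ.coeffLevelReduce (fun j ↦ V.torsionGaloisModule ((p : ℤ) ^ j)) t (shapiroIdeal p) (shapiroIdeal_succ_le p)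
          (fun j ↦ j) (omega_mem_shapiroIdeal p) σ y) =
      κ.shapiroToEisensteinTwistLe V hm (σ + 1) k hσ' hle' y := by
  rw [coeffLevelReduce, shapiroToEisensteinTwistLe, shapiroToEisensteinTwistLe]
  refine (κ.coeffTwistReduce_comp_apply _ _ _ _ _ _ _ _ _ _).trans ?_
  refine κ.coeffTwistReduce_congr _ _ _ _ (Ideal.Quotient.ringHom_ext (RingHom.ext fun g ↦ ?_)) (fun P ↦ ?_) _
  · simp only [RingHom.comp_apply, Ideal.Quotient.factor_mk, shapiroToEisensteinCoeff_mk]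
  · exact (congrArg (fun φ ↦ φ P) (V.torsionGaloisModulePowReduce_succ_eq_comp p σ k hσ (t σ) (ht σ))).symm

include ht in
/-- **(T2) `red′_k ∘ f_{σ,k+1} = f_{σ,k}`** on the carriers: mapping to `E[p^{k+1}] ⊗ A_{m,k+1}` then reducing one step in the
Eisenstein target (D1's `eisensteinTwistReduce hm _ (t k)`: `c ⊗ P ↦ (c mod) ⊗ t_k P`) is mapping to `E[p^k] ⊗ A_{m,k}`.
[cite: Howard2004HeegnerKolyvagin, Rem. 1.2.4 and §1.6 (arXiv p. 7 L13–27, p. 12 L29–33)] -/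
theorem eisensteinTwistReduce_shapiroToEisensteinTwistLe (σ k : ℕ) (hσ : k + 1 ≤ σ) (hσ' : k ≤ σ)
    (hle : shapiroIdeal p σ ≤ Ideal.span {(PowerSeries.X ^ m + PowerSeries.C (p : ℤ_[p]) : IwasawaAlgebra p)} ⊔
      Ideal.span {PowerSeries.C ((p : ℤ_[p]) ^ (k + 1))})
    (hle' : shapiroIdeal p σ ≤ Ideal.span {(PowerSeries.X ^ m + PowerSeries.C (p : ℤ_[p]) : IwasawaAlgebra p)} ⊔
      Ideal.span {PowerSeries.C ((p : ℤ_[p]) ^ k)})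
    (y : QuotTwisted (IwasawaAlgebra p ⧸ shapiroIdeal p σ) (WeierstrassCurve.geomTorsion V ((p : ℤ) ^ σ))) :
    κ.eisensteinTwistReduce hm (Nat.le_succ k) (t k) (κ.shapiroToEisensteinTwistLe V hm σ (k + 1) hσ hle y) =
      κ.shapiroToEisensteinTwistLe V hm σ k hσ' hle' y := by
  rw [eisensteinTwistReduce_eq_coeffTwistReduce, shapiroToEisensteinTwistLe, shapiroToEisensteinTwistLe]
  refine (κ.coeffTwistReduce_comp_apply _ _ _ _ _ _ _ _ _ _).trans ?_
  refine κ.coeffTwistReduce_congr _ _ _ _ (Ideal.Quotient.ringHom_ext (RingHom.ext fun g ↦ ?_)) (fun P ↦ Subtype.ext ?_) _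
  · simp only [RingHom.comp_apply, shapiroToEisensteinCoeff_mk, IwasawaAlgebra.EisensteinCoeff.reduce_mk]
  · change (((t k (V.torsionGaloisModulePowReduce p σ (k + 1) hσ P)) : WeierstrassCurve.geomTorsion V ((p : ℤ) ^ k)) :
        WeierstrassCurve.geomPoints V) = _
    rw [ht, WeierstrassCurve.coe_geomTorsionReduce, WeierstrassCurve.coe_torsionGaloisModulePowReduce,
      WeierstrassCurve.coe_torsionGaloisModulePowReduce, smul_smul, ← pow_succ',
      show σ - (k + 1) + 1 = σ - k by omega]

/-! ## §2 The local `H¹` forms along the two local towers -/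

section Local

variable [NumberField K]

include ht in
/-- **(T1) on local `H¹`**: `H¹(K_v, f_{σ,k}) ∘ (source local tower `𝐓_{σ+1} → 𝐓_σ`) = H¹(K_v, f_{σ+1,k})`
(lit's `coeffLocalRed` on the Shapiro diagonal). [cite: SerreGaloisCohomology1997, I §2.2 and §2.4] [cite: Howard2004HeegnerKolyvagin, Rem. 1.2.4 and Lemma 2.2.7] -/
theorem map_localMap_shapiroToEisensteinTwistLe_coeffLocalRed (v : NumberField.Place K) (σ k : ℕ) (hσ : k ≤ σ)
    (hσ' : k ≤ σ + 1)
    (hle : shapiroIdeal p σ ≤ Ideal.span {(PowerSeries.X ^ m + PowerSeries.C (p : ℤ_[p]) : IwasawaAlgebra p)} ⊔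
      Ideal.span {PowerSeries.C ((p : ℤ_[p]) ^ k)})
    (hle' : shapiroIdeal p (σ + 1) ≤ Ideal.span {(PowerSeries.X ^ m + PowerSeries.C (p : ℤ_[p]) : IwasawaAlgebra p)} ⊔
      Ideal.span {PowerSeries.C ((p : ℤ_[p]) ^ k)})
    (y : galoisCohomology (((κ.coeffAdicTower (fun j ↦ V.torsionGaloisModule ((p : ℤ) ^ j)) t (shapiroIdeal p)
      (shapiroIdeal_succ_le p) (fun j ↦ j) (omega_mem_shapiroIdeal p) (fun j ↦ j * p ^ j + j)
      (maximalIdeal_pow_le_shapiroIdeal p) hts).ρ (σ + 1)).toLocal v) 1) :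
    galoisCohomology.map (DiscreteGaloisModule.localMap (κ.shapiroToEisensteinTwistLe V hm σ k hσ hle) v) 1
        (κ.coeffLocalRed (fun j ↦ V.torsionGaloisModule ((p : ℤ) ^ j)) t (shapiroIdeal p) (shapiroIdeal_succ_le p)
          (fun j ↦ j) (omega_mem_shapiroIdeal p) (fun j ↦ j * p ^ j + j) (maximalIdeal_pow_le_shapiroIdeal p) hts v σ y) =
      galoisCohomology.map (DiscreteGaloisModule.localMap (κ.shapiroToEisensteinTwistLe V hm (σ + 1) k hσ' hle') v) 1 y := by
  rw [coeffLocalRed]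
  exact galoisCohomology.map_map_of_comp_apply
    (DiscreteGaloisModule.localMap (κ.coeffLevelReduce (fun j ↦ V.torsionGaloisModule ((p : ℤ) ^ j)) t (shapiroIdeal p)
      (shapiroIdeal_succ_le p) (fun j ↦ j) (omega_mem_shapiroIdeal p) σ) v)
    (DiscreteGaloisModule.localMap (κ.shapiroToEisensteinTwistLe V hm σ k hσ hle) v)
    (DiscreteGaloisModule.localMap (κ.shapiroToEisensteinTwistLe V hm (σ + 1) k hσ' hle') v)
    (fun x ↦ (κ.shapiroToEisensteinTwistLe_coeffLevelReduce t ht hm σ k hσ hσ' hle hle' x).symm) y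

include ht in
/-- **(T2) on local `H¹`**: (target local tower `H¹(K_v, W_{k+1}) → H¹(K_v, W_k)`, D1's `eisensteinLocalReduce`)
`∘ H¹(K_v, f_{σ,k+1}) = H¹(K_v, f_{σ,k})`. [cite: SerreGaloisCohomology1997, I §2.2 and §2.4] [cite: Howard2004HeegnerKolyvagin, Rem. 1.2.4 and Lemma 2.2.7] -/
theorem eisensteinLocalReduce_map_localMap_shapiroToEisensteinTwistLe (v : NumberField.Place K) (σ k : ℕ)
    (hσ : k + 1 ≤ σ) (hσ' : k ≤ σ)
    (hle : shapiroIdeal p σ ≤ Ideal.span {(PowerSeries.X ^ m + PowerSeries.C (p : ℤ_[p]) : IwasawaAlgebra p)} ⊔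
      Ideal.span {PowerSeries.C ((p : ℤ_[p]) ^ (k + 1))})
    (hle' : shapiroIdeal p σ ≤ Ideal.span {(PowerSeries.X ^ m + PowerSeries.C (p : ℤ_[p]) : IwasawaAlgebra p)} ⊔
      Ideal.span {PowerSeries.C ((p : ℤ_[p]) ^ k)})
    (y : galoisCohomology (((κ.coeffAdicTower (fun j ↦ V.torsionGaloisModule ((p : ℤ) ^ j)) t (shapiroIdeal p)
      (shapiroIdeal_succ_le p) (fun j ↦ j) (omega_mem_shapiroIdeal p) (fun j ↦ j * p ^ j + j)
      (maximalIdeal_pow_le_shapiroIdeal p) hts).ρ σ).toLocal v) 1) :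
    κ.eisensteinLocalReduce (fun j ↦ V.torsionGaloisModule ((p : ℤ) ^ j)) t hm v k
        (galoisCohomology.map (DiscreteGaloisModule.localMap (κ.shapiroToEisensteinTwistLe V hm σ (k + 1) hσ hle) v) 1 y) =
      galoisCohomology.map (DiscreteGaloisModule.localMap (κ.shapiroToEisensteinTwistLe V hm σ k hσ' hle') v) 1 y := by
  rw [eisensteinLocalReduce]
  exact galoisCohomology.map_map_of_comp_apply
    (DiscreteGaloisModule.localMap (κ.shapiroToEisensteinTwistLe V hm σ (k + 1) hσ hle) v)
    (DiscreteGaloisModule.localMap (κ.eisensteinTwistReduce hm (Nat.le_succ k) (t k)) v)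
    (DiscreteGaloisModule.localMap (κ.shapiroToEisensteinTwistLe V hm σ k hσ' hle') v)
    (fun x ↦ (κ.eisensteinTwistReduce_shapiroToEisensteinTwistLe t ht hm σ k hσ hσ' hle hle' x).symm) y

end Local

/-! ## §3 Admissibility `k ≤ σ ∧ (ω_σ, p^σ) ≤ (q_m, p^k)` -/

/-- Admissibility is upward closed in the source level (`I_{σ+1} ≤ I_σ`). [cite: Howard2004HeegnerKolyvagin, §2.2 Def. 2.2.3 and Lemma 2.2.7] -/
theorem adm_succ_of_adm (p : ℕ) [Fact p.Prime] (m : ℕ) {σ k : ℕ}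
    (h : k ≤ σ ∧ shapiroIdeal p σ ≤ Ideal.span {(PowerSeries.X ^ m + PowerSeries.C (p : ℤ_[p]) : IwasawaAlgebra p)} ⊔
      Ideal.span {PowerSeries.C ((p : ℤ_[p]) ^ k)}) :
    k ≤ σ + 1 ∧ shapiroIdeal p (σ + 1) ≤ Ideal.span {(PowerSeries.X ^ m + PowerSeries.C (p : ℤ_[p]) : IwasawaAlgebra p)} ⊔
      Ideal.span {PowerSeries.C ((p : ℤ_[p]) ^ k)} :=
  ⟨h.1.trans (Nat.le_succ σ), (shapiroIdeal_succ_le p σ).trans h.2⟩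

/-- **For every target level `k` some source level is admissible** (and then all larger ones): a choice function
`σ₀` with `k ≤ σ₀ k`, `(ω_{σ₀ k}, p^{σ₀ k}) ≤ (q_m, p^k)` (`exists_forall_shapiroIdeal_le`).
[cite: Howard2004HeegnerKolyvagin, Lemma 2.2.7 and Prop. 2.2.8 (arXiv p. 16)] [cite: Washington1997, §13.2 (Lemma 13.7)] -/
theorem exists_forall_adm (p : ℕ) [Fact p.Prime] {m : ℕ} (hm : 1 ≤ m) :
    ∃ σ₀ : ℕ → ℕ, ∀ k, k ≤ σ₀ k ∧ shapiroIdeal p (σ₀ k) ≤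
      Ideal.span {(PowerSeries.X ^ m + PowerSeries.C (p : ℤ_[p]) : IwasawaAlgebra p)} ⊔
        Ideal.span {PowerSeries.C ((p : ℤ_[p]) ^ k)} := by
  choose S hS using fun k ↦ exists_forall_shapiroIdeal_le p hm k
  exact ⟨fun k ↦ max (S k) k, fun k ↦ ⟨le_max_right _ _, hS k _ (le_max_left _ _)⟩⟩

/-! ## §4 Cores ↦ cores at the finite places -/

section Cores

variable [NumberField K] {v : HeightOneSpectrum (𝓞 K)}

omit hp in
include ht in
/-- `p^d· : E[p^{k+d}] → E[p^k]` carries `Fil_v E[p^{k+d}]` into `Fil_v E[p^k]` along ONE ordinary filtration `Φ` of the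
module tower (iterate `Φ.map_mem` along the lifts `t` of `p·`). [cite: Howard2004HeegnerKolyvagin, Def. 2.2.5 (arXiv p0016 L84–100)] -/
theorem OrdinaryFiltration.torsionGaloisModulePowReduce_add_mem_fil
    (Φ : OrdinaryFiltration (fun j ↦ V.torsionGaloisModule ((p : ℤ) ^ j)) t v) (k : ℕ) :
    ∀ (d : ℕ) (h : k ≤ k + d) {a : WeierstrassCurve.geomTorsion V ((p : ℤ) ^ (k + d))},
      a ∈ Φ.fil (k + d) → V.torsionGaloisModulePowReduce p (k + d) k h a ∈ Φ.fil k
  | 0, h, a, ha => by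
    have e : V.torsionGaloisModulePowReduce p (k + 0) k h a = a :=
      Subtype.ext (by rw [WeierstrassCurve.coe_torsionGaloisModulePowReduce, Nat.add_sub_cancel_left, pow_zero, one_smul])
    rw [e]
    exact ha
  | d + 1, h, a, ha => by
    have e := V.torsionGaloisModulePowReduce_succ_eq_comp p (k + d) k (Nat.le_add_right k d) (t (k + d)) (ht (k + d))
    change V.torsionGaloisModulePowReduce p (k + d + 1) k ((Nat.le_add_right k d).trans (Nat.le_succ _)) a ∈ Φ.fil k
    rw [e]
    exact OrdinaryFiltration.torsionGaloisModulePowReduce_add_mem_fil Φ k d (Nat.le_add_right k d)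
      (Φ.map_mem (k + d) a ha)

omit hp in
include ht in
/-- Along ONE ordinary filtration `Φ` of the module tower, `p^{σ−k}· : E[p^σ] → E[p^k]` carries `Fil_v E[p^σ]` into `Fil_v E[p^k]`
(iterate `Φ.map_mem` along the lifts `t` of `p·`). [cite: Howard2004HeegnerKolyvagin, Def. 2.2.5 (arXiv p0016 L84–100: Fil_v T, Fil_v 𝐓)] -/
theorem OrdinaryFiltration.torsionGaloisModulePowReduce_mem_fil
    (Φ : OrdinaryFiltration (fun j ↦ V.torsionGaloisModule ((p : ℤ) ^ j)) t v) (σ k : ℕ) (h : k ≤ σ)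
    {a : WeierstrassCurve.geomTorsion V ((p : ℤ) ^ σ)} (ha : a ∈ Φ.fil σ) :
    V.torsionGaloisModulePowReduce p σ k h a ∈ Φ.fil k := by
  obtain ⟨d, rfl⟩ := Nat.exists_eq_add_of_le h
  exact OrdinaryFiltration.torsionGaloisModulePowReduce_add_mem_fil t ht Φ k d h ha

include ht in
/-- **`f_{σ,k}` carries the source plus part `(Λ/I_σ) ⊗ Fil_v E[p^σ]` (lit's `coeffFil`) into the target plus part
`A_{m,k} ⊗ Fil_v E[p^k]` (D1's `twistedFil`)** — same ordinary filtration `Φ` on both sides.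
[cite: Howard2004HeegnerKolyvagin, Def. 2.2.5 and §3.1 (Fil_v 𝐓 = Fil_v T ⊗ Λ, Fil_v T_𝔮 = Fil_v T ⊗ S_𝔮)] -/
theorem shapiroToEisensteinTwistLe_mem_twistedFil
    (Φ : OrdinaryFiltration (fun j ↦ V.torsionGaloisModule ((p : ℤ) ^ j)) t v) (σ k : ℕ) (hσ : k ≤ σ)
    (hle : shapiroIdeal p σ ≤ Ideal.span {(PowerSeries.X ^ m + PowerSeries.C (p : ℤ_[p]) : IwasawaAlgebra p)} ⊔
      Ideal.span {PowerSeries.C ((p : ℤ_[p]) ^ k)})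
    {w : CoeffLevel p (shapiroIdeal p) (fun j ↦ WeierstrassCurve.geomTorsion V ((p : ℤ) ^ j)) σ}
    (hw : w ∈ coeffFil (shapiroIdeal p) Φ σ) :
    κ.shapiroToEisensteinTwistLe V hm σ k hσ hle (CoeffLevel.equivQuotTwisted σ w) ∈ Φ.twistedFil (m := m) k := by
  induction hw using Submodule.span_induction with
  | mem x hx =>
    obtain ⟨c, a, ha, rfl⟩ := hx
    change κ.shapiroToEisensteinTwistLe V hm σ k hσ hle (QuotTwisted.tmul c a) ∈ _
    rw [κ.shapiroToEisensteinTwistLe_tmul hm σ k hσ hle c a]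
    exact Φ.tmul_mem_twistedFil k _ (OrdinaryFiltration.torsionGaloisModulePowReduce_mem_fil t ht Φ σ k hσ ha)
  | zero => rw [map_zero, map_zero]; exact Submodule.zero_mem _
  | add x y _ _ hx hy => rw [map_add, map_add]; exact Submodule.add_mem _ hx hy
  | smul n x _ hx => rw [map_zsmul, map_zsmul]; exact Submodule.smul_mem _ n hx

include ht in
/-- **At `v ∣ p`: `H¹(K_v, f_{σ,k})` carries the source ordinary core (lit's `coeffOrdinaryCore`, strict condition for the
source plus part) into the target ordinary core (D1's `ordinaryCore`)** — the tree's `map_mem_strictSubgroup` with §4.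
[cite: Howard2004HeegnerKolyvagin, Def. 2.2.6 and Lemma 2.2.7 (arXiv p0016 L104–148)] [cite: GreenbergLNM1716, §2] -/
theorem map_localMap_shapiroToEisensteinTwistLe_mem_ordinaryCore
    (Φ : OrdinaryFiltration (fun j ↦ V.torsionGaloisModule ((p : ℤ) ^ j)) t v) (σ k : ℕ) (hσ : k ≤ σ)
    (hle : shapiroIdeal p σ ≤ Ideal.span {(PowerSeries.X ^ m + PowerSeries.C (p : ℤ_[p]) : IwasawaAlgebra p)} ⊔
      Ideal.span {PowerSeries.C ((p : ℤ_[p]) ^ k)})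
    {c : galoisCohomology (((κ.coeffAdicTower (fun j ↦ V.torsionGaloisModule ((p : ℤ) ^ j)) t (shapiroIdeal p)
      (shapiroIdeal_succ_le p) (fun j ↦ j) (omega_mem_shapiroIdeal p) (fun j ↦ j * p ^ j + j)
      (maximalIdeal_pow_le_shapiroIdeal p) hts).ρ σ).toLocal (Sum.inr v)) 1}
    (hc : c ∈ coeffOrdinaryCore (shapiroIdeal p) (shapiroIdeal_succ_le p) (fun j ↦ j) (omega_mem_shapiroIdeal p)
      (fun j ↦ j * p ^ j + j) (maximalIdeal_pow_le_shapiroIdeal p) hts Φ σ) :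
    galoisCohomology.map (DiscreteGaloisModule.localMap (κ.shapiroToEisensteinTwistLe V hm σ k hσ hle) (Sum.inr v)) 1 c ∈
      Φ.ordinaryCore hm k :=
  DiscreteGaloisModule.map_mem_strictSubgroup
    (DiscreteGaloisModule.localMap (κ.shapiroToEisensteinTwistLe V hm σ k hσ hle) (Sum.inr v)) _ _ _ _
    (fun _ hw ↦ κ.shapiroToEisensteinTwistLe_mem_twistedFil t ht hm Φ σ k hσ hle hw) hc

/-- **At any finite place: `H¹(K_v, f_{σ,k})` carries unramified classes to unramified classes.**
[cite: Howard2004HeegnerKolyvagin, Def. 1.1.1 and Lemma 1.1.9 (the unramified condition is functorial)] [cite: SerreGaloisCohomology1997, I §2.4] -/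
theorem map_localMap_shapiroToEisensteinTwistLe_mem_unramifiedSubgroup (σ k : ℕ) (hσ : k ≤ σ)
    (hle : shapiroIdeal p σ ≤ Ideal.span {(PowerSeries.X ^ m + PowerSeries.C (p : ℤ_[p]) : IwasawaAlgebra p)} ⊔
      Ideal.span {PowerSeries.C ((p : ℤ_[p]) ^ k)})
    {c : galoisCohomology (((κ.coeffAdicTower (fun j ↦ V.torsionGaloisModule ((p : ℤ) ^ j)) t (shapiroIdeal p)
      (shapiroIdeal_succ_le p) (fun j ↦ j) (omega_mem_shapiroIdeal p) (fun j ↦ j * p ^ j + j)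
      (maximalIdeal_pow_le_shapiroIdeal p) hts).ρ σ).toLocal (Sum.inr v)) 1}
    (hc : c ∈ DiscreteGaloisModule.unramifiedSubgroup (GaloisRep.toLocal v ((κ.coeffAdicTower
      (fun j ↦ V.torsionGaloisModule ((p : ℤ) ^ j)) t (shapiroIdeal p) (shapiroIdeal_succ_le p) (fun j ↦ j)
      (omega_mem_shapiroIdeal p) (fun j ↦ j * p ^ j + j) (maximalIdeal_pow_le_shapiroIdeal p) hts).ρ σ)) 1) :
    galoisCohomology.map (DiscreteGaloisModule.localMap (κ.shapiroToEisensteinTwistLe V hm σ k hσ hle) (Sum.inr v)) 1 c ∈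
      DiscreteGaloisModule.unramifiedSubgroup (GaloisRep.toLocal v (κ.eisensteinTwist (V.torsionGaloisModule ((p : ℤ) ^ k)) hm k)) 1 :=
  DiscreteGaloisModule.map_mem_unramifiedSubgroup _ hc

end Cores

end Literature.NumberTheory.EllipticCurves.ZpExtension

end
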